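import Summits.QuantumFields.BalabanUV.Beta.CombChartTransportLevel
import Summits.QuantumFields.BalabanUV.Beta.SymCorrectorSockets
import Summits.QuantumFields.BalabanUV.Beta.CombChartStepJets
import Summits.QuantumFields.BalabanUV.Beta.RecursiveStencilSlot

/-!
# `BalabanUV.Beta.GAN24.CombCubicStepTransport` — binder row G-an2-4 ∕ (CONV-C), TRANSFER-III (the G-an2-4 END at row D1's literal of record (III′)),
# S-SLOT SIDE, THE STRUCTURAL BRICK: **THE CUBIC STEP OF THE COMB-CHART RESOLVENT `G′_j = GcombSh Lc j` IS THE CUBIC STEP OF THE ROOTED bm STEP RESOLVENT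
# `G_j = coDressKBmAt ρ_c Lc (KInvStep Lc j)` ON `𝒯`-TRANSPORTED TABLES, `𝒯 S := κ u ↦ Ψ̂_Sᵀ ∘ (slotPsiS ρ_c Lc S) κ u ∘ Ψ̂_S` A FIXED, LEVEL-INDEPENDENT, LOCAL TABLE TRANSPORT —
# hence the (III′) S-tower `ScombOf` obeys the (E) recursion's LEVEL MAPS pre-composed with `𝒯`**
# (G-an2-4 CRUX TEAM (2), seat `b2b-balaban-gan24-p2` = road-P2 chair, gen 55; the OWNER gan24-p1 g46's (III′) link table R-gan24p1-g46-2 l.64934, row «S-slot at (III′) …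
# the (III′) sectors of `ScombOf = SrecOf tabs.V tabs.H (GcombSh Lc)` need the sector split + the CT rates re-run … NOBODY today» and its «RULED OUT: (III′) = Ψ̂_S-transport of (E),
# hence free — NO»: this file types exactly WHAT the chart transport does to the S-recursion — it does NOT make (III′) free, it interleaves ONE fixed local transport `𝒯` between
# the (E) level maps)

NOT IN PRINT; OUR BOOKKEEPING ([folklore] kernel bookkeeping BY NAME over an2 gen 49's `CombChartTransportLevel.GcombSh_eq_conj_psiKS_KInvStep` (`G′_j = Ψ̂_S ∘ G_j ∘ Ψ̂_Sᵀ`, every `j`),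
d1-formalise-leaf-03's `SymCorrectorSlot.vertexOfK_conj_psiKS` (the slot adjunction) ∕ `SymCorrectorKernel.comp_psiKS_inr ∕ comp_trK_psiKS_inr ∕ spr_psiKS` ∕
`SymCorrectorSockets.locStencil_slotPsiS`, an5's exchange lemmas `ChartConjugationReflection.comp_wsum ∕ wsum_comp ∕ vertexOfK_eq_sum ∕ summable_abs_colH ∕ loc_wsum_colH`,
an5's `TameKernelCalculus.comp_assoc_tame`, an2's `ValueJetGeneric.e3OfK` ∕ `RecursiveStencilSlot.SrecOf_succ` ∕ `CombChartStepJets`; 0 `def`, 0 cited fact, 0 `def … : Prop`, 0 sorry).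
HONEST FRAMING (cell contract, verbatim): «discharging `BetaPertH` makes Bałaban's UV stability UNCONDITIONAL — a real constructive-QFT result; it is NOT the continuum
limit and NOT the Clay problem.»  HONEST DEPENDENCY (verbatim): «continuum YM on T⁴ ⇐ BetaPertH ∧ nine spine estimates (0/9 proved); BetaPertH ⇐ (D1) ∧ (D4) ∧ CAP+tail;
G-an2-4 gates asym, D1 and NE2/3/4.»
ABSOLUTE RULE (cell charter, verbatim): «No internally-minted statement may enter as a cited fact. Every hypothesis is either kernel-proved in this package or a
verbatim quotation of a PUBLISHED theorem with page reference. The manuscript(s) under audit are NOT citable for their own disputed steps — they are the thing under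
adjudication; programme-internal (2001/route/tribunal) claims are never citable.»  Nothing is cited here.

## Why (context only; asserted nowhere below)
The (α-0) END at (E) got its S-slot rows from the CT-route over the RECURSION `SrecAt (j+1) = (cE·wE)•e3OfK Lc G_j (SrecAt j) + fresh`, `G_j = coDressKBmAt ρ_c Lc (KInvStep Lc j)`
(Wilson sector = `push₃` through the dressed leg chains of `G_j`, born sectors by Duhamel).  At (III′) the S-tower is `ScombOf tabs … = SrecOf tabs.V tabs.H (GcombSh Lc) …` with
`GcombSh Lc j = Ψ̂_S ∘ G_j ∘ Ψ̂_Sᵀ` for ALL `j` and ONE kernel `Ψ̂_S = psiKS (ctrOff (d+1) Lc) Lc` (an2).  The cubic step `e3OfK n K S = −mmRead n (K ∘ vertexOfK K n S ∘ K)` reads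
ONLY the multiplier–multiplier block of the sandwich, on which `Ψ̂_S` acts as the identity (its multiplier block is `1`, its mixed blocks `0`), and the chain-rule vertex of the
conjugated kernel is the vertex of `K` on the slot-transported table (leaf-03's slot adjunction).  So the two outer correctors DROP OUT and the two inner ones land on the
TABLE: `e3OfK n (Ψ̂∘K∘Ψ̂ᵀ) S = e3OfK n K (𝒯 S)` with `𝒯 S κ u := Ψ̂ᵀ ∘ (slotPsiS r n S) κ u ∘ Ψ̂` — a fixed, `j`-independent, locality-preserving linear transport of tables.

## What is proved (generic `d`)
* §1 entrywise bookkeeping (NO hypothesis): `comp_congr_row ∕ comp_congr_col`; **`mmRead_sandwich_conj_psiKS`** — for ANY `K V`: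
  `mmRead M ((K′∘V)∘K′) = mmRead M (((K∘Ψ̂ᵀ)∘V)∘(Ψ̂∘K))`, `K′ := Ψ̂∘K∘Ψ̂ᵀ` (the outer correctors are invisible to the `mm`-read).
* §2 **`conj_vertexOfK_eq_vertexOfK_conj`** — for spread `P`, decaying `K`, a local stencil family `S`: `Pᵀ ∘ vertexOfK K N S μ y ∘ P = vertexOfK K N (κ u ↦ Pᵀ ∘ S κ u ∘ P) μ y`
  (an5's exchange lemmas; the congruence twin of an5's `vertexOfK_conjV`).
* §3 **`e3OfK_conj_psiKS`** — for spread `K`, a local stencil family `S` (`0 < δ`), `0 < n`, `r ∈ box (d+1) n`, `Ψ̂ := psiKS r n`: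
  `e3OfK n (Ψ̂∘K∘Ψ̂ᵀ) S = e3OfK n K (κ u ↦ Ψ̂ᵀ ∘ slotPsiS r n S κ u ∘ Ψ̂)`; `locStencil_transportPsiS` (the transported family is a local stencil family, explicit constant).
* §4 THE (III′) INSTANCE (`[NeZero Lc]`, `ρ_c = ctr (d+1) Lc`, `G_j = coDressKBmAt ρ_c Lc (KInvStep Lc j)`): **`e3OfK_GcombSh_eq_bm_transport`** —
  `e3OfK Lc (GcombSh Lc j) S = e3OfK Lc G_j (κ u ↦ Ψ̂_Sᵀ ∘ slotPsiS (ctrOff (d+1) Lc) Lc S κ u ∘ Ψ̂_S)` for every local `S`; and the recursion consequence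
  **`ScombOf_succ_eq_bm_transport`** — for ANY sym record `tabs` and pins: `ScombOf tabs cE cVH cΛ (j+1) = (cE·wE (j+1)) • e3OfK Lc G_j (𝒯 (ScombOf tabs cE cVH cΛ j)) + (cVH·wVH (j+1)) • tabs.V
  + (cΛ·wΛ (j+1)) • SLam Lc (lamCoeffK (KInvStep Lc (j+1)) (E2 (j+1)) Lc) tabs.H` — THE (III′) S-TOWER RUNS THE (E) LEVEL MAPS `e3OfK Lc G_j` PRE-COMPOSED WITH THE ONE FIXED TRANSPORT `𝒯`; `SpureCombOf_succ_eq_bm_transport` (the pure tables, same reading).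
WHAT THIS IS NOT: no row of the S-slot at (III′) (the CT rates of the interleaved chain `… ∘ e3OfK G_{j+1} ∘ 𝒯 ∘ e3OfK G_j ∘ 𝒯 ∘ …` are the campaign — SIZED by this file as «the
(E) leg calculus with the fixed transport `𝒯` between consecutive levels», NOT discharged); no statement about `WcombOf` (the W-recursion reads `G′_j` also through `K2OfK ∕ dM`, whose
multiplier legs the correctors do NOT drop out of — not touched); NO value, NO rate; NO campaign opened (an2 W-4 l.64553 «not asked today» stands); NEVER «G-an2-4 closed» as (CONV-C);
NOT D1, NOT `BetaPertH`, NOT continuum, NOT Clay.  2026-08-25; no existing file touched.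
-/

noncomputable section

open Finset
open scoped BigOperators
open Literature.MathematicalPhysics.QuantumFieldTheory
open Literature.MathematicalPhysics.QuantumFieldTheory.Balaban1983to89
open Literature.MathematicalPhysics.QuantumFieldTheory.Balaban1983to89.Beta
open ExpKernelCalculus (MKer Decays BiLoc comp biLoc_comp_decays)
open KernelWard (bdd_of_biLoc comp_finset_sum_right comp_finset_sum_left)
open AffineAveraging (Site box toSite)
open AveragingContoursRooted (ctr ctrOff ctrOff_mem_box)
open OneStepResolventKernel (Fib wsum LocStencil)
open OneStepKernelFamily (KInvStep colH vertexOfK)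
open BalabanStepJetsSucc (mmRead mmRead_inl_inl mmRead_inr_left mmRead_inr_right biLoc_comp_right wE wVH wΛ E2 lamCoeffK)
open InterLevelTransport (SLam)
open Summit.QuantumFields.BalabanUV.Beta.TameKernelCalculus
open Summit.QuantumFields.BalabanUV.Beta.KernelWardRelative (loc_finset_sum)
open Summit.QuantumFields.BalabanUV.Beta.ChartConjugationReflection (comp_wsum wsum_comp vertexOfK_eq_sum summable_abs_colH loc_wsum_colH abs_le_of_locStencil)
open Summit.QuantumFields.BalabanUV.Beta.BorderedHessian (spr_KInvStep)
open Summit.QuantumFields.BalabanUV.Beta.AxialDressingRooted (coDressKBmAt spr_coDressKBmAt one_le_of_neZero)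
open Summit.QuantumFields.BalabanUV.Beta.SpineRooted (e3OfK e3OfK_apply SpureRecOf SpureRecOf_succ)
open Summit.QuantumFields.BalabanUV.Beta.WardLocusRecursive (SrecOf SrecOf_succ)
open Summit.QuantumFields.BalabanUV.Beta.SymmetrisedStepJets (SymTables)
open Summit.QuantumFields.BalabanUV.Beta.SymCorrectorKernel (psiKS comp_psiKS_inr comp_trK_psiKS_inr spr_psiKS)
open Summit.QuantumFields.BalabanUV.Beta.SymCorrectorFace (slotPsiS)
open Summit.QuantumFields.BalabanUV.Beta.SymCorrectorSlot (vertexOfK_conj_psiKS)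
open Summit.QuantumFields.BalabanUV.Beta.SymCorrectorSockets (locStencil_slotPsiS)
open Summit.QuantumFields.BalabanUV.Beta.CombChartStepJets (GcombSh ScombOf SpureCombOf ScombOf_eq SpureCombOf_eq locStencil_ScombOf)
open Summit.QuantumFields.BalabanUV.Beta.CombChartTransportLevel (GcombSh_eq_conj_psiKS_KInvStep)

namespace Summit.QuantumFields.BalabanUV.Beta.GAN24.CombCubicStepTransport

variable {d : ℕ}

/-! ## §1 The `mm`-read does not see the outer correctors -/

section MM

/-- [folklore] A composition `A ∘ B` read at the row `(x, a)` depends on `A` only through its row `(x, a)`. -/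
theorem comp_congr_row {A A' B : MKer (d + 1) (Fib d)} {x : Site (d + 1)} {a : Fib d} (h : ∀ t f, A x t a f = A' x t a f)
    (z : Site (d + 1)) (b : Fib d) : comp A B x z a b = comp A' B x z a b := by
  simp only [ExpKernelCalculus.comp, h]

/-- [folklore] A composition `A ∘ B` read at the column `(z, b)` depends on `B` only through its column `(z, b)`. -/
theorem comp_congr_col {A B B' : MKer (d + 1) (Fib d)} {z : Site (d + 1)} {b : Fib d} (h : ∀ t f, B t z f b = B' t z f b)
    (x : Site (d + 1)) (a : Fib d) : comp A B x z a b = comp A B' x z a b := by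
  simp only [ExpKernelCalculus.comp, h]

variable (r : Fin (d + 1) → ℕ) (n : ℕ)

/-- [folklore] **A MULTIPLIER ROW OF `Ψ̂ ∘ K ∘ Ψ̂ᵀ` IS THE SAME ROW OF `K ∘ Ψ̂ᵀ`** (`Ψ̂`'s multiplier block is the identity, its multiplier–field block zero:
`comp_psiKS_inr`; NO hypothesis on `K`). -/
theorem conj_psiKS_inr_row (K : MKer (d + 1) (Fib d)) (x t : Site (d + 1)) (α : Fin (d + 1)) (f : Fib d) :
    comp (comp (psiKS r n) K) (trK (psiKS r n)) x t (Sum.inr α) f = comp K (trK (psiKS r n)) x t (Sum.inr α) f :=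
  comp_congr_row (fun s e => comp_psiKS_inr (r := r) (n := n) K x s α e) t f

/-- [folklore] **A MULTIPLIER COLUMN OF `Ψ̂ ∘ K ∘ Ψ̂ᵀ` IS THE SAME COLUMN OF `Ψ̂ ∘ K`** (`comp_trK_psiKS_inr`; NO hypothesis on `K`). -/
theorem conj_psiKS_inr_col (K : MKer (d + 1) (Fib d)) (t z : Site (d + 1)) (f : Fib d) (β : Fin (d + 1)) :
    comp (comp (psiKS r n) K) (trK (psiKS r n)) t z f (Sum.inr β) = comp (psiKS r n) K t z f (Sum.inr β) :=
  comp_trK_psiKS_inr (r := r) (n := n) _ t z f β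

/-- NOT IN PRINT; OUR BOOKKEEPING ([folklore]; NO hypothesis).  **THE `mm`-READ OF THE SANDWICH DOES NOT SEE THE OUTER CORRECTORS**: for ANY kernels `K V` and
`K′ := Ψ̂ ∘ K ∘ Ψ̂ᵀ` (`Ψ̂ = psiKS r n`), `mmRead M ((K′ ∘ V) ∘ K′) = mmRead M (((K ∘ Ψ̂ᵀ) ∘ V) ∘ (Ψ̂ ∘ K))` — the `mm`-read takes the `(inr, inr)` block only, where the left
factor enters through a multiplier ROW of `K′` (= that row of `K ∘ Ψ̂ᵀ`) and the right factor through a multiplier COLUMN of `K′` (= that column of `Ψ̂ ∘ K`). -/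
theorem mmRead_sandwich_conj_psiKS (M : ℕ) (K V : MKer (d + 1) (Fib d)) :
    mmRead M (comp (comp (comp (comp (psiKS r n) K) (trK (psiKS r n))) V) (comp (comp (psiKS r n) K) (trK (psiKS r n))))
      = mmRead M (comp (comp (comp K (trK (psiKS r n))) V) (comp (psiKS r n) K)) := by
  funext x' z' a b
  rcases a with α | μ
  · rcases b with β | ν
    · rw [mmRead_inl_inl, mmRead_inl_inl]
      -- right factor: the multiplier column of `K′` is the column of `Ψ̂ ∘ K`
      rw [comp_congr_col (A := comp (comp (comp (psiKS r n) K) (trK (psiKS r n))) V)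
        (fun t f => conj_psiKS_inr_col r n K t ((M : ℤ) • z') f β) ((M : ℤ) • x') (Sum.inr α)]
      -- left factor: the multiplier row of `K′ ∘ V` is the row of `(K ∘ Ψ̂ᵀ) ∘ V`
      refine comp_congr_row (fun t f => ?_) _ _
      exact comp_congr_row (fun s e => conj_psiKS_inr_row r n K ((M : ℤ) • x') s α e) t f
    · rw [mmRead_inr_right, mmRead_inr_right]
  · rw [mmRead_inr_left, mmRead_inr_left]

end MM

/-! ## §2 A congruence of the chain-rule vertex is the vertex of the congruent tables -/

section Vertex

variable {N : ℕ}

/-- NOT IN PRINT; OUR BOOKKEEPING ([folklore]; the congruence twin of an5's `ChartConjugationReflection.vertexOfK_conjV`).  **`Pᵀ ∘ vertexOfK K N S μ y ∘ P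
= vertexOfK K N (κ u ↦ Pᵀ ∘ S κ u ∘ P) μ y`** for a spread `P`, a decaying `K` and a local stencil family `S` (two exchanges of absolutely convergent sums per slot index:
`comp_wsum` with `Pᵀ`, `wsum_comp` with `P`; the finite slot sum by `comp_finset_sum_right ∕ _left`). -/
theorem conj_vertexOfK_eq_vertexOfK_conj {P K : MKer (d + 1) (Fib d)} (hP : Spr P) (hK : ∃ δ C : ℝ, 0 < δ ∧ 0 ≤ C ∧ Decays K C δ)
    {S : Fin (d + 1) → (Fin (d + 1) → ℤ) → MKer (d + 1) (Fib d)} {Cs δs : ℝ} (hS : LocStencil S Cs δs) (hδs : 0 < δs)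
    (μ : Fin (d + 1)) (y : Fin (d + 1) → ℤ) :
    comp (comp (trK P) (vertexOfK K N S μ y)) P = vertexOfK K N (fun κ u => comp (comp (trK P) (S κ u)) P) μ y := by
  obtain ⟨CP, δP, hδP, hPd⟩ := id hP
  have hCs : 0 ≤ Cs := (hS 0 0).nonneg (Sum.inl 0)
  have hδ : 0 < min δP δs := lt_min hδP hδs
  have hPtd : Decays (trK P) (|CP|) (min δP δs) := decays_of_le (decays_trK hPd) (min_le_left δP δs)
  -- uniform bounds: `S` by `Cs`; `Pᵀ ∘ S u` by the (u-independent) constant of `biLoc_comp_decays`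
  have hB₁ : ∀ κ' u x z a b, |S κ' u x z a b| ≤ Cs := abs_le_of_locStencil hS hδs.le
  set B₂ := (Fintype.card (Fib d) : ℝ) * (|CP| * |Cs|) * ExpKernelCalculus.Zl (d + 1) (min δP δs - min δP δs / 2) with hB₂
  have hPS : ∀ κ' u, BiLoc (comp (trK P) (S κ' u)) u u B₂ (min δP δs / 2) := fun κ' u =>
    biLoc_comp_decays hPtd (biLoc_of_le (hS κ' u) (min_le_right δP δs)) (by linarith) (by linarith)
  have hbPS : ∀ κ' u x z a b, |comp (trK P) (S κ' u) x z a b| ≤ B₂ := fun κ' u => bdd_of_biLoc (hPS κ' u) (by linarith)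
  have hB₂0 : 0 ≤ B₂ := (abs_nonneg _).trans (hbPS 0 0 0 0 (Sum.inl 0) (Sum.inl 0))
  have hw := summable_abs_colH (N := N) hK μ y
  have hWl : ∀ κ', Loc (wsum (colH K N μ y κ') (S κ')) := fun κ' => loc_wsum_colH (N := N) hK hS hδs μ y κ'
  -- per slot index: two exchanges
  have e : ∀ κ', comp (comp (trK P) (wsum (colH K N μ y κ') (S κ'))) P
      = wsum (colH K N μ y κ') (fun u => comp (comp (trK P) (S κ' u)) P) := by
    intro κ'
    rw [comp_wsum hP.trK (hw κ') hCs (hB₁ κ'), wsum_comp hP (hw κ') hB₂0 (hbPS κ')]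
  rw [vertexOfK_eq_sum, vertexOfK_eq_sum,
    comp_finset_sum_right Finset.univ (fun κ' _ => slices_tame hP.trK.tame (hWl κ').tame)]
  have hPWl : ∀ κ', Loc (comp (trK P) (wsum (colH K N μ y κ') (S κ'))) := fun κ' => hP.trK.comp_loc (hWl κ')
  rw [comp_finset_sum_left Finset.univ (fun κ' _ => slices_tame (hPWl κ').tame hP.tame)]
  exact Finset.sum_congr rfl fun κ' _ => e κ'

end Vertex

/-! ## §3 The cubic step of a `Ψ̂`-conjugated kernel is the cubic step on `𝒯`-transported tables -/

section Cubic

variable {n : ℕ} (hn : 0 < n) {r : Fin (d + 1) → ℕ} (hr : r ∈ box (d + 1) n)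
include hn hr

/-- [folklore] **THE TRANSPORTED FAMILY `𝒯 S := κ u ↦ Ψ̂ᵀ ∘ slotPsiS r n S κ u ∘ Ψ̂` IS A LOCAL STENCIL FAMILY** (leaf-03's `locStencil_slotPsiS` — same rate, explicit constant —
then two `biLoc_comp_decays` with the spread `Ψ̂`, `Ψ̂ᵀ` at half and quarter rate). -/
theorem locStencil_transportPsiS {S : Fin (d + 1) → (Fin (d + 1) → ℤ) → MKer (d + 1) (Fib d)} {Cs δs : ℝ} (hS : LocStencil S Cs δs) (hδs : 0 < δs) :
    ∃ C δ : ℝ, 0 < δ ∧ LocStencil (fun κ u => comp (comp (trK (psiKS r n)) (slotPsiS r n S κ u)) (psiKS r n)) C δ := by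
  obtain ⟨CP, δP, hδP, hPd⟩ := spr_psiKS (d := d) hn hr
  have hT := locStencil_slotPsiS (d := d) hn r hS hδs.le
  have hm0 : 0 < min δP δs := lt_min hδP hδs
  have hPtd : Decays (trK (psiKS r n)) (|CP|) (min δP δs) := decays_of_le (decays_trK hPd) (min_le_left δP δs)
  have hPd' : Decays (psiKS r n) (|CP|) (min δP δs / 2) := decays_of_le hPd (by linarith [min_le_left δP δs])
  have key : ∀ κ u, BiLoc (comp (comp (trK (psiKS r n)) (slotPsiS r n S κ u)) (psiKS r n)) u u _ (min δP δs / 4) :=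
    fun κ u => biLoc_comp_right
      (biLoc_comp_decays hPtd (biLoc_of_le (hT κ u) (min_le_right δP δs)) (show 0 ≤ min δP δs / 2 by positivity) (by linarith))
      hPd' (show 0 ≤ min δP δs / 4 by positivity) (by linarith)
  exact ⟨_, _, by positivity, key⟩

/-- NOT IN PRINT; OUR BOOKKEEPING ([folklore]; THE STRUCTURAL BRICK).  **THE CUBIC STEP OF A `Ψ̂`-CONJUGATED KERNEL IS THE CUBIC STEP ON `𝒯`-TRANSPORTED TABLES**:
for spread `K`, a local stencil family `S` (`0 < δ`), `0 < n`, `r ∈ box (d+1) n`, `Ψ̂ := psiKS r n`: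
`e3OfK n (Ψ̂ ∘ K ∘ Ψ̂ᵀ) S = e3OfK n K (κ u ↦ Ψ̂ᵀ ∘ slotPsiS r n S κ u ∘ Ψ̂)`.
(The vertex of the conjugated kernel is `vertexOfK K n (slotPsiS r n S)` — leaf-03's slot adjunction; the `mm`-read drops the outer correctors (§1); three re-associations of
tame kernels; the inner `Ψ̂ᵀ · Ψ̂` move into the slot (§2).) -/
theorem e3OfK_conj_psiKS {K : MKer (d + 1) (Fib d)} (hK : Spr K)
    {S : Fin (d + 1) → (Fin (d + 1) → ℤ) → MKer (d + 1) (Fib d)} {Cs δs : ℝ} (hS : LocStencil S Cs δs) (hδs : 0 < δs) :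
    e3OfK n (comp (comp (psiKS r n) K) (trK (psiKS r n))) S
      = e3OfK n K (fun κ u => comp (comp (trK (psiKS r n)) (slotPsiS r n S κ u)) (psiKS r n)) := by
  have hΨ : Spr (psiKS r n) := spr_psiKS hn hr
  have hΨt : Spr (trK (psiKS r n)) := hΨ.trK
  have hK' : ∃ δ C : ℝ, 0 < δ ∧ 0 ≤ C ∧ Decays K C δ := by
    obtain ⟨C, δ, hδ, hKd⟩ := hK
    exact ⟨δ, |C|, hδ, abs_nonneg C, decays_of_le hKd le_rfl⟩
  -- the slot-transported family and its vertex
  have hT := locStencil_slotPsiS (d := d) hn r hS hδs.le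
  funext κ u x z a b
  rw [e3OfK_apply, e3OfK_apply, vertexOfK_conj_psiKS hn hr hK hS hδs κ u]
  congr 1
  -- the outer correctors drop out of the `mm`-read
  rw [mmRead_sandwich_conj_psiKS r n n K (vertexOfK K n (slotPsiS r n S) κ u)]
  -- the vertex of the slot-transported LOCAL family is localised, hence tame
  have hV : Loc (vertexOfK K n (slotPsiS r n S) κ u) := by
    rw [vertexOfK_eq_sum]
    exact loc_finset_sum _ fun κ' => loc_wsum_colH (N := n) hK' hT hδs κ u κ'
  have hW : Loc (comp (trK (psiKS r n)) (vertexOfK K n (slotPsiS r n S) κ u)) := hΨt.comp_loc hV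
  have hKW : Loc (comp K (comp (trK (psiKS r n)) (vertexOfK K n (slotPsiS r n S) κ u))) := hK.comp_loc hW
  -- three re-associations: ((K∘Ψ̂ᵀ)∘V)∘(Ψ̂∘K) = (K∘((Ψ̂ᵀ∘V)∘Ψ̂))∘K
  rw [← comp_assoc_tame hK.tame hΨt.tame hV.tame, comp_assoc_tame hKW.tame hΨ.tame hK.tame,
    ← comp_assoc_tame hK.tame hW.tame hΨ.tame]
  -- the inner correctors move into the slot
  rw [conj_vertexOfK_eq_vertexOfK_conj hΨ hK' hT hδs κ u]

end Cubic

/-! ## §4 The (III′) instance: the comb-chart cubic step and the S-recursion of `ScombOf` -/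

section Comb

variable {Lc : ℕ} [NeZero Lc]

/-- NOT IN PRINT; OUR BOOKKEEPING ([folklore]; THE (III′) CUBIC STEP).  **`e3OfK Lc (GcombSh Lc j) S = e3OfK Lc G_j (𝒯 S)`** with `G_j = coDressKBmAt ρ_c Lc (KInvStep Lc j)` the
ROOTED bm STEP RESOLVENT of the chart-(II) tower (E) and `𝒯 S := κ u ↦ Ψ̂_Sᵀ ∘ slotPsiS (ctrOff (d+1) Lc) Lc S κ u ∘ Ψ̂_S`, `Ψ̂_S = psiKS (ctrOff (d+1) Lc) Lc` — the SAME transport at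
EVERY level `j` (an2's `GcombSh_eq_conj_psiKS_KInvStep` ⨾ §3). -/
theorem e3OfK_GcombSh_eq_bm_transport (j : ℕ) {S : Fin (d + 1) → (Fin (d + 1) → ℤ) → MKer (d + 1) (Fib d)} {Cs δs : ℝ}
    (hS : LocStencil S Cs δs) (hδs : 0 < δs) :
    e3OfK Lc (GcombSh (d := d) Lc j) S
      = e3OfK Lc (coDressKBmAt (ctr (d + 1) Lc) Lc (KInvStep (d := d) Lc j))
          (fun κ u => comp (comp (trK (psiKS (ctrOff (d + 1) Lc) Lc)) (slotPsiS (ctrOff (d + 1) Lc) Lc S κ u)) (psiKS (ctrOff (d + 1) Lc) Lc)) := by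
  have hLc : 0 < Lc := Nat.pos_of_ne_zero (NeZero.ne Lc)
  have hr : ctrOff (d + 1) Lc ∈ box (d + 1) Lc := ctrOff_mem_box hLc
  rw [GcombSh_eq_conj_psiKS_KInvStep Lc j]
  exact e3OfK_conj_psiKS hLc hr (spr_coDressKBmAt hLc hr (spr_KInvStep j)) hS hδs

/-- NOT IN PRINT; OUR BOOKKEEPING ([folklore]; THE (III′) S-RECURSION READ ON THE bm CHART).  **THE COMB-CHART S-TOWER RUNS THE (E) LEVEL MAPS PRE-COMPOSED WITH THE ONE
FIXED TRANSPORT `𝒯`**: for ANY sym record `tabs : SymTables d Lc` and ANY pins `cE cVH cΛ`, at every level,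
`ScombOf tabs cE cVH cΛ (j+1) = (cE·wE (j+1)) • e3OfK Lc G_j (𝒯 (ScombOf tabs cE cVH cΛ j)) + (cVH·wVH (j+1)) • tabs.V + (cΛ·wΛ (j+1)) • SLam Lc (lamCoeffK (KInvStep Lc (j+1)) (E2 (j+1)) Lc) tabs.H`
(an2's `SrecOf_succ` at the comb slots + `e3OfK_GcombSh_eq_bm_transport` on the local member `j` — an2's `locStencil_ScombOf`).  Compare (E): `SrecAt (j+1) = (cE·wE (j+1)) • e3OfK Lc G_j (SrecAt j) +
(cVH·wVH (j+1)) • vhSAt ρ_c + (cΛ·wΛ (j+1)) • SLam … (hessFFAt ρ_c)` — the SAME level map `e3OfK Lc G_j`, the tables swapped for an1's sym tables, and `𝒯` interleaved. -/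
theorem ScombOf_succ_eq_bm_transport (tabs : SymTables d Lc) (cE cVH cΛ : ℝ) (j : ℕ) :
    ScombOf tabs cE cVH cΛ (j + 1) = fun κ' u' =>
      (cE * wE d Lc (j + 1)) •
          e3OfK Lc (coDressKBmAt (ctr (d + 1) Lc) Lc (KInvStep (d := d) Lc j))
            (fun κ u => comp (comp (trK (psiKS (ctrOff (d + 1) Lc) Lc)) (slotPsiS (ctrOff (d + 1) Lc) Lc (ScombOf tabs cE cVH cΛ j) κ u))
              (psiKS (ctrOff (d + 1) Lc) Lc)) κ' u' +
        (cVH * wVH d Lc (j + 1)) • tabs.V κ' u' +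
        (cΛ * wΛ d Lc (j + 1)) • SLam Lc (lamCoeffK (KInvStep (d := d) Lc (j + 1)) (E2 d Lc (j + 1)) Lc) tabs.H κ' u' := by
  obtain ⟨Cs, δs, hδs, hS⟩ := locStencil_ScombOf tabs cE cVH cΛ j
  rw [ScombOf_eq, SrecOf_succ, ← ScombOf_eq, e3OfK_GcombSh_eq_bm_transport j hS hδs]

/-- NOT IN PRINT; OUR BOOKKEEPING ([folklore]).  **THE PURE (Λ-FREE) TABLES OF THE COMB CHART, SAME READING**: for ANY sym record and pins, at every level,
`SpureCombOf tabs cE cVH cΛ (j+1) = (cE·wE (j+1)) • e3OfK Lc G_j (𝒯 (ScombOf tabs cE cVH cΛ j)) + (cVH·wVH (j+1)) • tabs.V` (an2's `SpureRecOf_succ` — the cubic sector reads the FOLDED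
member `j` — + `e3OfK_GcombSh_eq_bm_transport`); these are the first-order tables the (III′) W-tower `WcombOf` and its Ward law read. -/
theorem SpureCombOf_succ_eq_bm_transport (tabs : SymTables d Lc) (cE cVH cΛ : ℝ) (j : ℕ) :
    SpureCombOf tabs cE cVH cΛ (j + 1) = fun κ' u' =>
      (cE * wE d Lc (j + 1)) •
          e3OfK Lc (coDressKBmAt (ctr (d + 1) Lc) Lc (KInvStep (d := d) Lc j))
            (fun κ u => comp (comp (trK (psiKS (ctrOff (d + 1) Lc) Lc)) (slotPsiS (ctrOff (d + 1) Lc) Lc (ScombOf tabs cE cVH cΛ j) κ u))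
              (psiKS (ctrOff (d + 1) Lc) Lc)) κ' u' +
        (cVH * wVH d Lc (j + 1)) • tabs.V κ' u' := by
  obtain ⟨Cs, δs, hδs, hS⟩ := locStencil_ScombOf tabs cE cVH cΛ j
  rw [SpureCombOf_eq, SpureRecOf_succ, ← ScombOf_eq, e3OfK_GcombSh_eq_bm_transport j hS hδs]

end Comb

end Summit.QuantumFields.BalabanUV.Beta.GAN24.CombCubicStepTransport

end
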